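import Summits.QuantumFields.YangMills.Theorems.FemtoTransferGapSpectralSumsRootCrossPointwise
import HarnessLib

/-!
# BLOCK-TO-FINE ROOT INEQUALITIES, part 4b: ★★ the CROSS DOOR — fine cross terms of two once-block-dressed vectors from their BLOCK cross terms
# (crux idea «block-endpoint» on crux `DressedRitz`, stmt-QuantumFields-20205; LEAD prover ym-lead-20205-polyakovlift g4)

For TWO once-dressed vectors `u = K^ℓ ũ`, `u' = K^ℓ ũ'` on one eigen-sequence (`λ_k ≥ 0`, coefficients `a_k`, `b_k`), the fine symmetrised coupling (clause (o6)/(A6′)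
of line «polyakovlift») is `D_ab − m̄N_ab = Σ_k a_k b_k λ_k^{2ℓ}(λ_k − m̄)`, `m̄ = (D_a/N_a + D_b/N_b)/2` the mean fine Rayleigh quotient.  With `X₀ = m̄^ℓ`:

* ★★ `SpecSum.cross_door`: `|D_ab − m̄N_ab − (m̄/(ℓX₀))(T_ab − X₀N_ab)| ≤ (m̄/(2ℓ))·(τ·N_a·Φ_a + N_b·Φ_b/τ)` for every `τ > 0`,
  `Φ_a = (32Θ⁴ + 8Θ)δ + 32Θ²(T_a/N_a/X₀ − 1)²` — the block defects `δ` (raw and dressed) of `a` and the mismatch of its block mean with the common centre;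
  `Θ` bounds the spectrum (`λ_k^ℓ ≤ ΘX₀`) and the block means (`X₀/Θ ≤ T/N ≤ ΘX₀`).  So the FINE cross term is the BLOCK cross term (times `m̄/(ℓX₀)`) up to
  `O((δ + mismatch²)/ℓ)·m̄√(N_aN_b)`: the `1/L` of (o6) is manufactured from `L`-free block data.

HONEST FRAMING: real-analysis plumbing for the femto-universe infrastructure of the CONDITIONAL rung R2b1; nothing here bears on infinite volume, the continuum limit or
the Clay gap.  References: Reed–Simon IV, Thm. XIII.1 [cite: ReedSimonIV1978, Thm. XIII.1].
-/

set_option autoImplicit false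

noncomputable section

open Finset
open scoped BigOperators

namespace Summit.QuantumFields.YangMills.Theorems.FemtoTransferGap.SpecSum

section Cross

open Root

variable {lam a b : ℕ → ℝ} {ℓ : ℕ}
  {Aa nva Ra Na Da Ta Qa Ab nvb Rb Nb Db Tb Qb Nab Dab Tab δ Θ τ : ℝ}

/-- ★★ **CROSS DOOR.**  Two once-dressed vectors on one eigen-sequence (`λ_k ≥ 0`; coefficients `a_k`, `b_k`; dressed norms `N`, fine forms `D`, block forms `T`,
double-block forms `Q`, raw sums `A ≤ nv`, `R`; cross sums `N_ab, D_ab, T_ab`), both with raw and dressed block defects `≤ δ ≤ 1/32`, block means within a factor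
`Θ` of the common centre `X₀ = m̄^ℓ` (`m̄ = (D_a/N_a + D_b/N_b)/2`) and spectrum below `Θ·X₀`:  for every `τ > 0`,
`|D_ab − m̄N_ab − (m̄/(ℓX₀))(T_ab − X₀N_ab)| ≤ (m̄/(2ℓ))·(τ N_a Φ_a + N_b Φ_b/τ)`, `Φ_a = (32Θ⁴ + 8Θ)δ + 32Θ²(T_a/N_a/X₀ − 1)²` — the FINE cross term is the
BLOCK cross term times `m̄/(ℓX₀)` up to `O((δ + mismatch²)/ℓ)`. [cite: ReedSimonIV1978, Thm. XIII.1] -/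
theorem cross_door (hnn : ∀ k, 0 ≤ lam k) (hℓ : 1 ≤ ℓ)
    (hAa : HasSum (fun k => a k ^ 2) Aa) (hRa : HasSum (fun k => lam k ^ ℓ * a k ^ 2) Ra)
    (hNa : HasSum (fun k => lam k ^ (2 * ℓ) * a k ^ 2) Na) (hDa : HasSum (fun k => lam k ^ (2 * ℓ + 1) * a k ^ 2) Da)
    (hTa : HasSum (fun k => lam k ^ (3 * ℓ) * a k ^ 2) Ta) (hQa : HasSum (fun k => lam k ^ (4 * ℓ) * a k ^ 2) Qa)
    (hAb : HasSum (fun k => b k ^ 2) Ab) (hRb : HasSum (fun k => lam k ^ ℓ * b k ^ 2) Rb)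
    (hNb : HasSum (fun k => lam k ^ (2 * ℓ) * b k ^ 2) Nb) (hDb : HasSum (fun k => lam k ^ (2 * ℓ + 1) * b k ^ 2) Db)
    (hTb : HasSum (fun k => lam k ^ (3 * ℓ) * b k ^ 2) Tb) (hQb : HasSum (fun k => lam k ^ (4 * ℓ) * b k ^ 2) Qb)
    (hNab : HasSum (fun k => lam k ^ (2 * ℓ) * (a k * b k)) Nab) (hDab : HasSum (fun k => lam k ^ (2 * ℓ + 1) * (a k * b k)) Dab)
    (hTab : HasSum (fun k => lam k ^ (3 * ℓ) * (a k * b k)) Tab)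
    (hNa0 : 0 < Na) (hNb0 : 0 < Nb) (hAanv : Aa ≤ nva) (hAbnv : Ab ≤ nvb) (hδ0 : 0 ≤ δ) (hδ : δ ≤ 1 / 32)
    (H1a : Na * nva ≤ (1 + δ) * Ra ^ 2) (H2a : Qa * Na ≤ (1 + δ) * Ta ^ 2)
    (H1b : Nb * nvb ≤ (1 + δ) * Rb ^ 2) (H2b : Qb * Nb ≤ (1 + δ) * Tb ^ 2)
    (hΘ : 1 ≤ Θ)
    (hXa1 : Ta / Na ≤ Θ * ((Da / Na + Db / Nb) / 2) ^ ℓ) (hXa2 : ((Da / Na + Db / Nb) / 2) ^ ℓ ≤ Θ * (Ta / Na))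
    (hXb1 : Tb / Nb ≤ Θ * ((Da / Na + Db / Nb) / 2) ^ ℓ) (hXb2 : ((Da / Na + Db / Nb) / 2) ^ ℓ ≤ Θ * (Tb / Nb))
    (htop : ∀ k, lam k ^ ℓ ≤ Θ * ((Da / Na + Db / Nb) / 2) ^ ℓ) (hτ : 0 < τ) :
    |Dab - (Da / Na + Db / Nb) / 2 * Nab -
        (Da / Na + Db / Nb) / 2 / (ℓ * ((Da / Na + Db / Nb) / 2) ^ ℓ) * (Tab - ((Da / Na + Db / Nb) / 2) ^ ℓ * Nab)| ≤
      (Da / Na + Db / Nb) / 2 / (2 * ℓ) *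
        (τ * Na * ((32 * Θ ^ 4 + 8 * Θ) * δ + 32 * Θ ^ 2 * (Ta / Na / ((Da / Na + Db / Nb) / 2) ^ ℓ - 1) ^ 2) +
          Nb * ((32 * Θ ^ 4 + 8 * Θ) * δ + 32 * Θ ^ 2 * (Tb / Nb / ((Da / Na + Db / Nb) / 2) ^ ℓ - 1) ^ 2) / τ) := by
  have hℓne : ℓ ≠ 0 := by omega
  have hℓpos : (0 : ℝ) < ℓ := by exact_mod_cast hℓ
  have hΘpos : 0 < Θ := by linarith
  have hTa0 := S3l_pos hnn hRa hNa hTa hNa0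
  have hTb0 := S3l_pos hnn hRb hNb hTb hNb0
  have hXa0 : 0 < Ta / Na := div_pos hTa0 hNa0
  have hXb0 : 0 < Tb / Nb := div_pos hTb0 hNb0
  set mb := (Da / Na + Db / Nb) / 2 with hmb
  set X0 := mb ^ ℓ with hX0
  have hX0pos : 0 < X0 := lt_of_lt_of_le (div_pos hXa0 hΘpos) (by rw [div_le_iff₀ hΘpos, mul_comm]; exact hXa1)
  have hDa0 : 0 ≤ Da := hDa.nonneg fun k => mul_nonneg (pow_nonneg (hnn k) _) (sq_nonneg _)
  have hDb0 : 0 ≤ Db := hDb.nonneg fun k => mul_nonneg (pow_nonneg (hnn k) _) (sq_nonneg _)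
  have hmb0 : 0 ≤ mb := by rw [hmb]; positivity
  have hmbpos : 0 < mb := by
    rcases hmb0.eq_or_lt with h | h
    · exfalso; rw [← h, zero_pow hℓne] at hX0; linarith
    · exact h
  have hAa0 := bessel_pos hAa hNa hNa0
  have hAb0 := bessel_pos hAb hNb hNb0
  have hRa0 := Sl_pos hnn hRa hNa hNa0
  have hRb0 := Sl_pos hnn hRb hNb hNb0
  set ma := Ra / Aa with hma
  set mb' := Rb / Ab with hmb'
  have hcmpa : Ta / Na < 4 * ma := means_cmp hnn hAa hRa hNa hTa hQa hNa0 hAanv hδ0 hδ H1a H2a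
  have hcmpb : Tb / Nb < 4 * mb' := means_cmp hnn hAb hRb hNb hTb hQb hNb0 hAbnv hδ0 hδ H1b H2b
  have hρa : 1 / (4 * Θ) ≤ ma / X0 := by
    rw [div_le_div_iff₀ (by positivity) hX0pos]; nlinarith [hXa2, hcmpa.le, hΘpos.le]
  have hρb : 1 / (4 * Θ) ≤ mb' / X0 := by
    rw [div_le_div_iff₀ (by positivity) hX0pos]; nlinarith [hXb2, hcmpb.le, hΘpos.le]
  -- the term series
  have hF : HasSum (fun k => (lam k ^ ℓ) ^ 2 * (a k * b k) * (lam k - mb - mb / (ℓ * X0) * (lam k ^ ℓ - X0)))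
      (Dab - mb * Nab - mb / (ℓ * X0) * (Tab - X0 * Nab)) := by
    have := (hDab.sub (hNab.mul_left mb)).sub ((hTab.sub (hNab.mul_left X0)).mul_left (mb / (ℓ * X0)))
    refine this.congr_fun fun k => ?_
    simp only [pow_two_mul_eq, pow_two_mul_add_one_eq, pow_three_mul_eq]; ring
  -- the dominating series
  have hWa := hasSum_dressed_centred hNa hTa hQa X0
  have hWb := hasSum_dressed_centred hNb hTb hQb X0
  have hV1a := hasSum_raw_centred hAa hRa hNa ma
  have hV1b := hasSum_raw_centred hAb hRb hNb mb'
  have hG : HasSum (fun k => mb / (2 * ℓ) *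
      (τ * (32 * Θ ^ 2 / X0 ^ 2 * ((lam k ^ ℓ) ^ 2 * a k ^ 2 * (lam k ^ ℓ - X0) ^ 2) + 8 * Θ * (a k ^ 2 * (lam k ^ ℓ - ma) ^ 2)) +
        (32 * Θ ^ 2 / X0 ^ 2 * ((lam k ^ ℓ) ^ 2 * b k ^ 2 * (lam k ^ ℓ - X0) ^ 2) + 8 * Θ * (b k ^ 2 * (lam k ^ ℓ - mb') ^ 2)) / τ))
      (mb / (2 * ℓ) *
        (τ * (32 * Θ ^ 2 / X0 ^ 2 * (Qa - 2 * X0 * Ta + X0 ^ 2 * Na) + 8 * Θ * (Na - 2 * ma * Ra + ma ^ 2 * Aa)) +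
          (32 * Θ ^ 2 / X0 ^ 2 * (Qb - 2 * X0 * Tb + X0 ^ 2 * Nb) + 8 * Θ * (Nb - 2 * mb' * Rb + mb' ^ 2 * Ab)) / τ)) := by
    have := (((((hWa.mul_left (32 * Θ ^ 2 / X0 ^ 2)).add (hV1a.mul_left (8 * Θ))).mul_left τ).add
      (((hWb.mul_left (32 * Θ ^ 2 / X0 ^ 2)).add (hV1b.mul_left (8 * Θ))).div_const τ)).mul_left (mb / (2 * ℓ)))
    refine this.congr_fun fun k => ?_
    simp only [pow_two_mul_eq]
  have hpt := fun k => cross_term_bound (a := a k) (b := b k) (hnn k) hmbpos hX0 hΘ hℓ (htop k) hρa hρb hτ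
  have hle1 := hasSum_le (fun k => (abs_le.1 (hpt k)).2) hF hG
  have hle2 := hasSum_le (fun k => neg_le.1 (abs_le.1 (hpt k)).1) hF.neg hG
  -- bound the dominating sum by the defects
  have hv2a := dressed_var_le hNa0 H2a
  have hv2b := dressed_var_le hNb0 H2b
  have hv1a := raw_var_le hAa hRa hNa hNa0 hAanv hδ0 H1a
  have hv1b := raw_var_le hAb hRb hNb hNb0 hAbnv hδ0 H1b
  rw [← hma] at hv1a
  rw [← hmb'] at hv1b
  have hGa := cross_major_bound hNa0 hX0pos hΘpos.le hδ0 hv2a hv1a hXa1 hXa0.le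
  have hGb := cross_major_bound hNb0 hX0pos hΘpos.le hδ0 hv2b hv1b hXb1 hXb0.le
  have hGa' := mul_le_mul_of_nonneg_left hGa hτ.le
  have hGb' := div_le_div_of_nonneg_right hGb hτ.le
  have hcoef : 0 ≤ mb / (2 * ℓ) := by positivity
  have hGle := mul_le_mul_of_nonneg_left (add_le_add hGa' hGb') hcoef
  have hid : mb / (2 * ℓ) * (τ * (Na * ((32 * Θ ^ 4 + 8 * Θ) * δ + 32 * Θ ^ 2 * (Ta / Na / X0 - 1) ^ 2)) +
      Nb * ((32 * Θ ^ 4 + 8 * Θ) * δ + 32 * Θ ^ 2 * (Tb / Nb / X0 - 1) ^ 2) / τ) =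
      mb / (2 * ℓ) * (τ * Na * ((32 * Θ ^ 4 + 8 * Θ) * δ + 32 * Θ ^ 2 * (Ta / Na / X0 - 1) ^ 2) +
      Nb * ((32 * Θ ^ 4 + 8 * Θ) * δ + 32 * Θ ^ 2 * (Tb / Nb / X0 - 1) ^ 2) / τ) := by ring
  rw [hid] at hGle
  rw [abs_le]
  constructor
  · linarith [hle2, hGle]
  · linarith [hle1, hGle]

end Cross

end Summit.QuantumFields.YangMills.Theorems.FemtoTransferGap.SpecSum

end
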